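import Summits.AnomalousDissipation.AnomalousDissipation.Theorems.SoloBlindSweptGalilean
import Summits.AnomalousDissipation.AnomalousDissipation.Theorems.SoloBlindGalileanLeaf
import Literature.Analysis.FluidPDE.LerayHopfGalileanTorusMeans
import Literature.Analysis.FluidPDE.LongTimeAverageNonneg
import Literature.Analysis.FluidPDE.LerayHopfRestartTorus
import Literature.Analysis.FluidPDE.LerayHopfMomentum
import Literature.Analysis.FluidPDE.LongTimeAverageShift

/-!
# Solo (blind) — the momentum leaf closed: `ZerothLaw ↔ TranslatingZerothLaw₀'`

`SoloBlindGalileanLeaf` proved `ZerothLaw → TranslatingZerothLaw₀`: every witness family of the zeroth law can be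
boosted to ZERO MOMENTUM at the price of sweeping the fixed pattern `f` at bounded constant velocities `c_j`
(`‖c_j‖² ≤ E`). With the swept-force Galilean covariance of `SoloBlindSweptGalilean` the boost is undone, and the
leaf closes on the version of `TranslatingZerothLaw₀` with `L²` data:

* `meanDissipation_galilean_anyForce`: the mean dissipation is frame independent (any force);
  `meanEnergy_galilean_le_of_momentum_zero`: at zero momentum the energy slices in the moving frame are
  `∫‖u t‖² + ‖V‖²`, so the mean energy moves by at most `‖V‖²` — honestly when the running energy means are
  bounded, onto the junk value `0` otherwise (`longTimeAvgSup_add_const_le` / `_eq_zero`); either way `≤ E + K`.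
* `exists_galilean_zeroMomentum_memLp` (`ZerothLaw`-side): restart a steady-force solution at a good time
  (`exists_isGlobalLerayHopf_translate`: datum `u(s) ∈ L²`, same means by `meanEnergy_translate` /
  `meanDissipation_translate`), then boost by the conserved momentum `c = ∫ u(s)` (`‖c‖² ≤ ⟨‖u‖₂²⟩`).
* `exists_unsweep` (converse side): unsweep by `−c` (`isGlobalLerayHopf_unsweep`): steady force, mean energy
  `≤ 2E`, same mean dissipation.
* `TranslatingZerothLaw₀'` and `translatingZerothLaw₀'_of_zerothLaw`, `zerothLaw_of_translatingZerothLaw₀'`,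
  `zerothLaw_iff_translatingZerothLaw₀'`, `translatingZerothLaw₀_of_translatingZerothLaw₀'`.

Upshot for the record: the summit is EQUIVALENT to a zero-momentum statement about one smooth pattern swept at
bounded constant velocities with honest data; the only residue between the summit and the zero-momentum STEADY
law `ZerothLaw₀` is the sweeping (`c_j ≠ 0`), not the momentum.

[cite: Frisch1995, §2.2 (Galilean invariance of Navier–Stokes on the periodic box)] [folklore]
-/

noncomputable section

open MeasureTheory Set Filter Topology
open scoped InnerProductSpace RealInnerProductSpace ENNReal NNReal ContDiff

namespace Summit.AnomalousDissipation.AnomalousDissipation.Theorems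

open Literature.Analysis.FunctionSpaces Literature.Analysis.FunctionSpaces.Torus UnitAddTorus
open Literature.Analysis.FluidPDE Literature.Analysis.FluidPDE.Torus

variable {d : Type*} [Fintype d] [DecidableEq d]

/-! ### Long-time means in the moving frame (any force) -/

section Means

variable {ν : ℝ} {F : ℝ → UnitAddTorus d → EuclideanSpace ℝ d}
  {u₀ : UnitAddTorus d → EuclideanSpace ℝ d} {u : ℝ → UnitAddTorus d → EuclideanSpace ℝ d}

/-- **The mean dissipation is frame independent** (any force). [folklore] -/
theorem meanDissipation_galilean_anyForce (hu : Torus.IsGlobalLerayHopf ν F u₀ u)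
    (V : EuclideanSpace ℝ d) :
    meanDissipation ν (fun t y => u t (y + proj (t • V)) - V) = meanDissipation ν u :=
  longTimeAvgSup_congr_of_eqOn_Ioi fun t ht => by
    rw [eGradNormSq_comp_add_right_sub_const ((hu.memLp_two ht.le).integrable one_le_two)]

/-- **Energy slices in the moving frame at zero momentum**: `∫‖u t (· + a) − V‖² = ∫‖u t‖² + ‖V‖²` when
`∫ u t = 0`. [folklore] -/
theorem integral_norm_sq_galilean_of_momentum_zero (hu : Torus.IsGlobalLerayHopf ν F u₀ u)
    {t : ℝ} (ht : 0 ≤ t) (hm : ∫ y, u t y = 0) (a : UnitAddTorus d) (V : EuclideanSpace ℝ d) :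
    ∫ y, ‖u t (y + a) - V‖ ^ 2 = (∫ y, ‖u t y‖ ^ 2) + ‖V‖ ^ 2 := by
  rw [integral_norm_sq_comp_add_right_sub_const (hu.memLp_two ht) a V, hm, inner_zero_left, mul_zero,
    sub_zero]

/-- A long-time average with unbounded running means is the junk value `0`. [folklore] -/
theorem longTimeAvgSup_eq_zero_of_not_isBoundedUnder {g : ℝ → ℝ}
    (h : ¬ IsBoundedUnder (· ≤ ·) atTop (timeMean g)) : longTimeAvgSup g = 0 := by
  unfold longTimeAvgSup
  rw [Filter.limsup_eq]
  have hempty : {a : ℝ | ∀ᶠ n in atTop, timeMean g n ≤ a} = ∅ := by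
    ext a
    simp only [Set.mem_setOf_eq, Set.mem_empty_iff_false, iff_false]
    intro ha
    exact h ⟨a, ha⟩
  rw [hempty, Real.sInf_empty]

/-- **Shifting an observable by a nonnegative constant shifts its long-time average by at most the
constant** — honestly when the running means are bounded, and onto the junk value `0` otherwise:
`⟨g + k⟩ ≤ max (⟨g⟩ + k) 0`... stated as the two cases used below. Bounded case. [folklore] -/
theorem longTimeAvgSup_add_const_le {g : ℝ → ℝ} {k : ℝ} (hg0 : ∀ t, 0 ≤ g t) (hk : 0 ≤ k)
    (hgi : ∀ T, 0 < T → IntegrableOn g (Ioc 0 T)) (hb : IsBoundedUnder (· ≤ ·) atTop (timeMean g)) :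
    longTimeAvgSup (fun t => g t + k) ≤ longTimeAvgSup g + k := by
  have hconst : ∀ T, 0 < T → timeMean (fun _ : ℝ => k) T = k := fun T hT => by
    unfold timeMean
    rw [intervalIntegral.integral_const, smul_eq_mul, sub_zero, ← mul_assoc, inv_mul_cancel₀ hT.ne', one_mul]
  have hkb : IsBoundedUnder (· ≤ ·) atTop (timeMean fun _ : ℝ => k) := by
    refine ⟨k, ?_⟩
    rw [eventually_map]
    exact (eventually_gt_atTop (0 : ℝ)).mono fun T hT => (hconst T hT).le
  have hki : ∀ T, 0 < T → IntegrableOn (fun _ : ℝ => k) (Ioc 0 T) := fun T _ =>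
    integrableOn_const (hs := measure_Ioc_lt_top.ne)
  have h := longTimeAvgSup_le_add_of_le_add (u := fun t => g t + k) (fun t => add_nonneg (hg0 t) hk) hg0
    (fun _ => hk) hgi hki hb hkb (fun t _ => le_rfl)
  have hK : longTimeAvgSup (fun _ : ℝ => k) ≤ k := longTimeAvgSup_le_const (fun _ => hk) fun _ _ => le_rfl
  linarith

/-- Unbounded case: the running means of `g + k` are unbounded too, so `⟨g + k⟩` is the junk `0`. [folklore] -/
theorem longTimeAvgSup_add_const_eq_zero {g : ℝ → ℝ} {k : ℝ}
    (hgi : ∀ T, 0 < T → IntegrableOn g (Ioc 0 T)) (hb : ¬ IsBoundedUnder (· ≤ ·) atTop (timeMean g)) :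
    longTimeAvgSup (fun t => g t + k) = 0 := by
  refine longTimeAvgSup_eq_zero_of_not_isBoundedUnder fun hbk => hb ?_
  obtain ⟨b, hbk⟩ := hbk
  rw [eventually_map] at hbk
  refine ⟨b - k, ?_⟩
  rw [eventually_map]
  filter_upwards [hbk, eventually_gt_atTop (0 : ℝ)] with T hT hTpos
  have hki : IntegrableOn (fun _ : ℝ => k) (Ioc 0 T) := integrableOn_const (hs := measure_Ioc_lt_top.ne)
  have hsplit : timeMean (fun t => g t + k) T = timeMean g T + k := by
    rw [timeMean_add hTpos.le (hgi T hTpos) hki]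
    unfold timeMean
    rw [intervalIntegral.integral_const, smul_eq_mul, sub_zero, ← mul_assoc, inv_mul_cancel₀ hTpos.ne', one_mul]
  linarith

/-- **Mean energy in the steady frame at zero momentum.** For a global Leray–Hopf solution `u` (any force) with
`∫ u t = 0` for all `t > 0` and `meanEnergy u ≤ E`, `0 ≤ K`, `‖V‖² ≤ K`: the field `u t (· + [tV]) − V` has
`meanEnergy ≤ E + K` (slices `∫‖u t‖² + ‖V‖²`; honest when the running energy means are bounded, junk `0`
otherwise). [folklore] -/
theorem meanEnergy_galilean_le_of_momentum_zero (hu : Torus.IsGlobalLerayHopf ν F u₀ u)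
    (hm : ∀ t, 0 < t → ∫ y, u t y = 0) {E K : ℝ} (hE : meanEnergy u ≤ E) (hK : 0 ≤ K)
    (V : EuclideanSpace ℝ d) (hV : ‖V‖ ^ 2 ≤ K) :
    meanEnergy (fun t y => u t (y + proj (t • V)) - V) ≤ E + K := by
  have hE0 : 0 ≤ E := (longTimeAvgSup_nonneg fun t => integral_nonneg fun _ => sq_nonneg _).trans
    ((meanEnergy_eq_longTimeAvgSup u).symm.le.trans hE)
  rw [meanEnergy_eq_longTimeAvgSup]
  rw [longTimeAvgSup_congr_of_eqOn_Ioi (g' := fun t => (∫ y, ‖u t y‖ ^ 2) + ‖V‖ ^ 2)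
    (fun t ht => integral_norm_sq_galilean_of_momentum_zero hu ht.le (hm t ht) _ V)]
  have hgi : ∀ T, 0 < T → IntegrableOn (fun t => ∫ y, ‖u t y‖ ^ 2) (Ioc 0 T) := fun T hT =>
    hu.integrableOn_integral_norm_sq hT
  by_cases hb : IsBoundedUnder (· ≤ ·) atTop (timeMean fun t => ∫ y, ‖u t y‖ ^ 2)
  · have h := longTimeAvgSup_add_const_le (fun t => integral_nonneg fun _ => sq_nonneg _) (sq_nonneg ‖V‖) hgi hb
    rw [← meanEnergy_eq_longTimeAvgSup] at h
    linarith
  · rw [longTimeAvgSup_add_const_eq_zero hgi hb]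
    linarith

end Means

/-! ### The momentum leaf closed: `ZerothLaw ↔ TranslatingZerothLaw₀'` (three dimensions) -/

section Leaf

variable {ν : ℝ} {f u₀ : UnitAddTorus (Fin 3) → EuclideanSpace ℝ (Fin 3)}
  {u : ℝ → UnitAddTorus (Fin 3) → EuclideanSpace ℝ (Fin 3)}

/-- **Zero-momentum co-moving representative with an honest datum.** For every global Leray–Hopf solution `u`
of `NS_ν(f)` (`ν > 0`, `f` steady smooth mean zero) there are a constant velocity `c`, `‖c‖² ≤ ⟨‖u‖₂²⟩`, and a
global Leray–Hopf solution `v` driven by `f` swept at `c`, from an `L²` MEAN-ZERO datum, with ZERO MOMENTUM at all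
positive times, the same mean dissipation and mean energy `≤ 4⟨‖u‖₂²⟩`: restart `u` at a good time `s`
(`exists_isGlobalLerayHopf_translate`: datum `u(s) ∈ L²`), then boost by the conserved momentum `c = ∫ u(s)`.
[cite: Frisch1995, §2.2] -/
theorem exists_galilean_zeroMomentum_memLp (hν : 0 < ν) (hu : Torus.IsGlobalLerayHopf ν (fun _ => f) u₀ u)
    (hf : IsSmooth f) (hf0 : HasZeroMean f) :
    ∃ (c : EuclideanSpace ℝ (Fin 3)) (v₀ : UnitAddTorus (Fin 3) → EuclideanSpace ℝ (Fin 3))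
      (v : ℝ → UnitAddTorus (Fin 3) → EuclideanSpace ℝ (Fin 3)),
      ‖c‖ ^ 2 ≤ meanEnergy u ∧
        Torus.IsGlobalLerayHopf ν (fun t y => f (y + proj (t • c))) v₀ v ∧ MemLp v₀ 2 volume ∧
        HasZeroMean v₀ ∧ (∀ t, 0 < t → ∫ y, v t y = 0) ∧
        meanEnergy v ≤ 4 * meanEnergy u ∧ meanDissipation ν v = meanDissipation ν u := by
  obtain ⟨s, hs, -, hR⟩ := hu.exists_isGlobalLerayHopf_translate hf hν.le
  have hL2 : MemLp (u s) 2 volume := hu.memLp_two hs.le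
  have hint : Integrable (u s) volume := hL2.integrable one_le_two
  set m : EuclideanSpace ℝ (Fin 3) := ∫ y, u s y with hm
  have hmom : ∀ t, 0 < t → ∫ y, u (t + s) y = m := fun t ht =>
    hu.integral_eq_integral_of_hasZeroMean (hf.memLp 2) hf0 hs (by linarith)
  have hcE : ‖m‖ ^ 2 ≤ meanEnergy u := norm_sq_momentum_le_meanEnergy hν hu hf hf0 hs
  have h0 : (fun t => u (t + s)) 0 = u s := by simp only [zero_add]
  have hB := hR.galilean_unboost hf hf0 h0 m
  refine ⟨m, fun y => u s y - m, fun t y => u (t + s) (y + proj (t • m)) - m, hcE, hB,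
    hL2.sub (memLp_const m), ?_, ?_, ?_, ?_⟩
  · show ∫ y, (u s y - m) = 0
    rw [integral_sub hint (integrable_const m), integral_const]
    simp [Measure.real, hm]
  · intro t ht
    have huti : Integrable (u (t + s)) volume := (hu.memLp_two (by linarith)).integrable one_le_two
    show ∫ y, (u (t + s) (y + proj (t • m)) - m) = 0
    rw [integral_sub (huti.comp_add_right _) (integrable_const m), integral_const,
      integral_add_right_eq_self (u (t + s)) (proj (t • m)), hmom t ht]
    simp [Measure.real]
  · have h1 := hR.meanEnergy_galilean_le hν hf hf0 m
    have h2 := hu.meanEnergy_translate hs.le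
    linarith
  · rw [hR.meanDissipation_galilean m, hu.meanDissipation_translate hν.le hs.le]

/-- **Back to the steady frame with controlled means.** A zero-momentum global Leray–Hopf solution with `L²` datum,
driven by `f` swept at `c` with `‖c‖² ≤ E` and mean energy `≤ E`, yields a global Leray–Hopf solution of the STEADY
problem `NS_ν(f)` with mean energy `≤ 2E` and the same mean dissipation (`isGlobalLerayHopf_unsweep`,
`meanEnergy_galilean_le_of_momentum_zero`). [cite: Frisch1995, §2.2] -/
theorem exists_unsweep (c : EuclideanSpace ℝ (Fin 3))
    (hu : Torus.IsGlobalLerayHopf ν (fun t y => f (y + proj (t • c))) u₀ u) (hf : IsSmooth f)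
    (hf0 : HasZeroMean f) (hu₀ : MemLp u₀ 2 volume) (hm : ∀ t, 0 < t → ∫ y, u t y = 0) {E : ℝ}
    (hcE : ‖c‖ ^ 2 ≤ E) (hE : meanEnergy u ≤ E) :
    ∃ (w₀ : UnitAddTorus (Fin 3) → EuclideanSpace ℝ (Fin 3))
      (w : ℝ → UnitAddTorus (Fin 3) → EuclideanSpace ℝ (Fin 3)),
      Torus.IsGlobalLerayHopf ν (fun _ => f) w₀ w ∧ meanEnergy w ≤ E + E ∧
        meanDissipation ν w = meanDissipation ν u := by
  have hU := hu.update_zero hu₀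
  have hUeq : ∀ t, 0 < t → Function.update u 0 u₀ t = u t := fun t ht => Function.update_of_ne ht.ne' _ _
  have hmU : ∀ t, 0 < t → ∫ y, Function.update u 0 u₀ t y = 0 := fun t ht => by rw [hUeq t ht]; exact hm t ht
  have hEU : meanEnergy (Function.update u 0 u₀) ≤ E := by rw [meanEnergy_congr_of_eqOn_Ioi hUeq]; exact hE
  refine ⟨_, _, isGlobalLerayHopf_unsweep c hu hf hf0 hu₀, ?_, ?_⟩
  · exact meanEnergy_galilean_le_of_momentum_zero hU hmU hEU ((sq_nonneg _).trans hcE) (-c)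
      (by rwa [norm_neg])
  · rw [meanDissipation_galilean_anyForce hU (-c), meanDissipation_congr_of_eqOn_Ioi hUeq]

/-- OPEN CONJECTURE — **the zeroth law at zero momentum for uniformly translating forces, honest data**
(registered open statement, stated here): `TranslatingZerothLaw₀` with the data required to lie in `L²`
(so that the time-zero slice can be normalised and the Galilean boost undone). EQUIVALENT to the summit
(`zerothLaw_iff_translatingZerothLaw₀'`); users keep the explicit hypothesis.
[cite: BrueDeLellis2023, §2 Questions 2.1–2.2 (swept-force reformulation, posed here)] -/
@[conjecture] def TranslatingZerothLaw₀' : Prop :=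
  ∃ f : UnitAddTorus (Fin 3) → EuclideanSpace ℝ (Fin 3), IsSmooth f ∧ IsDivFree f ∧ HasZeroMean f ∧
    ∃ (ν : ℕ → ℝ) (c : ℕ → EuclideanSpace ℝ (Fin 3))
      (u₀ : ℕ → UnitAddTorus (Fin 3) → EuclideanSpace ℝ (Fin 3))
      (u : ℕ → ℝ → UnitAddTorus (Fin 3) → EuclideanSpace ℝ (Fin 3)),
      (∀ j, 0 < ν j) ∧ Tendsto ν atTop (𝓝 0) ∧
        (∀ j, Torus.IsGlobalLerayHopf (ν j) (fun t y => f (y + proj (t • c j))) (u₀ j) (u j)) ∧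
        (∀ j, MemLp (u₀ j) 2 volume) ∧
        (∀ j, HasZeroMean (u₀ j)) ∧ (∀ j t, 0 < t → ∫ y, u j t y = 0) ∧
        (∃ E : ℝ, ∀ j, ‖c j‖ ^ 2 ≤ E ∧ meanEnergy (u j) ≤ E) ∧
        ∃ ε : ℝ, 0 < ε ∧ ∀ j, ε ≤ meanDissipation (ν j) (u j)

/-- **`ZerothLaw → TranslatingZerothLaw₀'`**: restart each witness at a good time, boost to zero momentum
(`exists_galilean_zeroMomentum_memLp`): sweeping velocity `‖c_j‖² ≤ E`, energy bound `4E`, same floor.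
[cite: Frisch1995, §2.2] -/
theorem translatingZerothLaw₀'_of_zerothLaw (h : Literature.Turb.ZerothLaw) : TranslatingZerothLaw₀' := by
  obtain ⟨f, hf, hdiv, hf0, ν, u₀, u, hν, hν0, hLH, ⟨E, hE⟩, ε, hε, hεle⟩ := h
  have hw := fun j => exists_galilean_zeroMomentum_memLp (hν j) (hLH j) hf hf0
  choose c v₀ v hc hB hL2 hz₀ hz hEv hDv using hw
  refine ⟨f, hf, hdiv, hf0, ν, c, v₀, v, hν, hν0, hB, hL2, hz₀, hz, ⟨4 * E, fun j => ⟨?_, ?_⟩⟩, ε, hε,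
    fun j => ?_⟩
  · linarith [hc j, hE j, (sq_nonneg _).trans (hc j)]
  · linarith [hEv j, hE j]
  · rw [hDv j]; exact hεle j

/-- **`TranslatingZerothLaw₀' → ZerothLaw`**: undo the sweeping of each witness by the boost `-c_j`
(`exists_unsweep`): steady force `f`, energy bound `2E`, same floor. [cite: Frisch1995, §2.2] -/
theorem zerothLaw_of_translatingZerothLaw₀' (h : TranslatingZerothLaw₀') : Literature.Turb.ZerothLaw := by
  obtain ⟨f, hf, hdiv, hf0, ν, c, u₀, u, hν, hν0, hLH, hL2, -, hz, ⟨E, hE⟩, ε, hε, hεle⟩ := h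
  have hw := fun j => exists_unsweep (c j) (hLH j) hf hf0 (hL2 j) (hz j) (hE j).1 (hE j).2
  choose w₀ w hW hEw hDw using hw
  exact ⟨f, hf, hdiv, hf0, ν, w₀, w, hν, hν0, hW, ⟨E + E, hEw⟩, ε, hε, fun j => (hDw j).symm ▸ hεle j⟩

/-- **The momentum leaf is closed**: the zeroth law for one fixed smooth steady force is EQUIVALENT to the
zeroth law at zero momentum for the same pattern swept at bounded constant velocities (honest data).
[cite: Frisch1995, §2.2] -/
theorem zerothLaw_iff_translatingZerothLaw₀' : Literature.Turb.ZerothLaw ↔ TranslatingZerothLaw₀' :=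
  ⟨translatingZerothLaw₀'_of_zerothLaw, zerothLaw_of_translatingZerothLaw₀'⟩

/-- `TranslatingZerothLaw₀'` from the summit (stated against the summit constant). [folklore] -/
theorem translatingZerothLaw₀'_of_anomalousDissipation (h : _root_.AnomalousDissipation) :
    TranslatingZerothLaw₀' :=
  zerothLaw_iff_translatingZerothLaw₀'.mp h

/-- `TranslatingZerothLaw₀' → TranslatingZerothLaw₀` (forget that the data are in `L²`). [folklore] -/
theorem translatingZerothLaw₀_of_translatingZerothLaw₀' (h : TranslatingZerothLaw₀') : TranslatingZerothLaw₀ := by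
  obtain ⟨f, hf, hdiv, hf0, ν, c, u₀, u, hν, hν0, hLH, -, hz₀, hz, hE, hε⟩ := h
  exact ⟨f, hf, hdiv, hf0, ν, c, u₀, u, hν, hν0, hLH, hz₀, hz, hE, hε⟩

end Leaf

end Summit.AnomalousDissipation.AnomalousDissipation.Theorems

end
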